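import Summits.Ventures.PercRepro.S2DichotomyTools
import Summits.Ventures.PercRepro.S2TailCell
import Summits.Ventures.PercRepro.S2SpanningCount
import Summits.Ventures.PercRepro.S2CountsCell
import Summits.Ventures.PercRepro.S2SpreadTail
import Summits.Ventures.PercRepro.S2FlatSharp
import Summits.Ventures.PercRepro.S2BasesTriangles
import Summits.Ventures.PercRepro.S2CobasisSix
import Summits.Ventures.PercRepro.S2FifteenSixScaled
import Summits.Ventures.PercRepro.S2ColoopSharp
import Summits.Ventures.PercRepro.S2PhiFifteenFive
import Summits.Ventures.PercRepro.S2CapFree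
import Summits.Ventures.PercRepro.TriangleCapEightI
import Summits.Ventures.PercRepro.RankLevelSetFourCircuitNullityFour
import Summits.Ventures.PercRepro.S1FiveCircuitBase

/-!
# PercRepro — S2: THE CELL `(15, 6)` MODULO THE TRIANGLE COUNT OF A SPREAD CORE (p7, gen 12; sub-claim S2)

The last cell of the `p = 15` row. Coloop-free: the cases `ν = 5, 4` by the concentrated tail; the SPREAD case (no set of nullity `4` on `≤ 9`
points, none of nullity `5` on `≤ 10`) by the triangle trade-off — `s₃ ≤ 3`: the sharp count against the kit's spanning bound; `s₃ = 4`: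
against three triangles' Bonferroni on the bases; `5 ≤ s₃ ≤ 8`: the top `6`-sets are COBASES and through each triangle there are `≤ 452`
of them (g6's Lemma A gives every triangle a disjoint circuit of `≤ 4` points; `S2.ncard_cobases_through_add_le`), `≤ 29,692 + …` against
`30,577`. What is NOT here: «a spread core of nullity `6` has `≤ 8` triangles» — taken as the hypothesis `hsix` (S2 v36 §R3⁗(u) proves `≤ 6`
on paper: every triangle not inside the union of the earlier ones raises the nullity, and the first contained one forces a `K₄` block).
**`ThmN.c025_core_five_fifteen_six_of_triangles (hsix) (M) [M.Finite] (hR : ρ(E) = 15) (hn : |E| = 21) (hfree) : RLS M 15 5`**.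
Every numeral from lean-drafts/p7/g12/mining/gencell15six.py (six.py). Axioms: standard.
-/

open scoped Matroid

namespace PercRepro

namespace ThmN

open Set

variable {α : Type}

/-- The coloop-free caps at `(15, 6)`: `s₃ ≤ 10`, `s₄ ≤ 34` (`⌊21·28/17⌋` on `avgChain16 5`), `s₅ ≤ 153` (`⌊21·117/16⌋`) on every
`e`-free core of nullity `6` on `21` points without coloops. -/
theorem caps_fifteen_six_cf_tk (M : Matroid α) [M.Finite]
    (hd : M.E.encard = M.eRank + ((6 : ℕ) : ℕ∞)) (hn : M.E.ncard = 15 + 6)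
    (hfree : ∀ e ∈ M.E, ∃ A ⊆ M.E \ {e}, e ∉ M.closure A ∧ e ∉ M.closure ((M.E \ {e}) \ A)) (hK : ∀ e, ¬ M.IsColoop e) :
    {C : Set α | M.IsCircuit C ∧ C.ncard = 3}.ncard ≤ 10 ∧
      {C : Set α | M.IsCircuit C ∧ C.ncard = 4}.ncard ≤ 34 ∧
        {C : Set α | M.IsCircuit C ∧ C.ncard = 5}.ncard ≤ 153 := by
  have hs3 := TriangleCap.core_ncard_triangles_le_cq3 M hfree hd
  rw [show TriangleCap.cq3 6 = 10 by decide] at hs3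
  have hcol : M.coloops = ∅ := S2.coloops_eq_empty_of_forall_not M hK
  have hm : 21 ≤ (M.E \ M.coloops).ncard := by
    rw [hcol, Set.sdiff_empty, hn]
  have hd' : M.E.encard = M.eRank + (((5 : ℕ) : ℕ∞) + 1) := by
    rw [hd]; norm_num
  have h := S1.ncard_fourCircuits_sub_div_le_of_nonColoops M hfree hd' (by norm_num) hm (B := 28)
    (fun M' _ hfree' hd'' => by
      have h := ncard_fourCircuits_le_avgChain16 5 M' hfree' hd''
      rw [show avgChain16 5 = 28 by decide] at h
      exact h)
  have hs4 : {C : Set α | M.IsCircuit C ∧ C.ncard = 4}.ncard ≤ 34 := by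
    have := S1.le_mul_div_of_sub_div_le (by norm_num : 4 < 21) h
    omega
  have hs5 := S2.ncard_fiveCircuits_le_of_no_coloop M hfree hd' hK (by omega)
  rw [hn] at hs5
  have h5 : (15 + 6) * S1.avgChain5b 5 / (15 + 6 - 5) = 153 := by
    rw [show S1.avgChain5b 5 = 117 by decide]
  rw [h5] at hs5
  exact ⟨hs3, hs4, hs5⟩

/-- **Lemma A for a triangle given as a set**: with `≥ 5` triangles, every triangle `T` has a circuit of `≤ 4` points avoiding it
(`S2.exists_circuit_le_four_disjoint_of_five_triangles` on the finset of triangles). -/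
theorem exists_circuit_le_four_disjoint_of_five_triangles_set (M : Matroid α) [M.Finite]
    (hC1 : ∀ L ⊆ M.E, M.eRk L = 2 → L.ncard ≤ 3) (h5 : 5 ≤ {C : Set α | M.IsCircuit C ∧ C.ncard = 3}.ncard)
    {T : Set α} (hT : M.IsCircuit T) (hT3 : T.ncard = 3) :
    ∃ C : Set α, M.IsCircuit C ∧ C.ncard ≤ 4 ∧ Disjoint C T := by
  classical
  set Ef := Matroid.groundF M with hEf
  set T3 : Finset (Finset α) := (Ef.powersetCard 3).filter (fun C : Finset α => M.IsCircuit (C : Set α)) with hT3def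
  have hT3mem : ∀ T ∈ T3, M.IsCircuit (T : Set α) ∧ T.card = 3 := by
    intro T hT
    rw [hT3def, Finset.mem_filter, Finset.mem_powersetCard] at hT
    exact ⟨hT.2, hT.1.2⟩
  have hT3card : T3.card = {C : Set α | M.IsCircuit C ∧ C.ncard = 3}.ncard := by
    rw [← Matroid.card_circF]
    have himg : Matroid.circF M 3 = T3.image (fun s : Finset α => (s : Set α)) := by
      ext C
      rw [Matroid.mem_circF, Finset.mem_image]
      constructor
      · rintro ⟨hC, hC3⟩
        have hCfin : C.Finite := M.ground_finite.subset hC.subset_ground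
        refine ⟨hCfin.toFinset, ?_, by simp⟩
        rw [hT3def, Finset.mem_filter, Finset.mem_powersetCard]
        refine ⟨⟨?_, ?_⟩, by simpa using hC⟩
        · intro x hx
          rw [Set.Finite.mem_toFinset] at hx
          rw [hEf, Matroid.groundF, Set.Finite.mem_toFinset]
          exact hC.subset_ground hx
        · rw [← Set.ncard_eq_toFinset_card C hCfin]; exact hC3
      · rintro ⟨s, hs, rfl⟩
        obtain ⟨hsc, hs3⟩ := hT3mem s hs
        exact ⟨hsc, by rw [Set.ncard_coe_finset]; exact hs3⟩
    rw [himg, Finset.card_image_of_injective _ Finset.coe_injective]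
  have hTfin : T.Finite := M.ground_finite.subset hT.subset_ground
  have hcT : ((hTfin.toFinset : Finset α) : Set α) = T := Set.Finite.coe_toFinset _
  have hTmem : hTfin.toFinset ∈ T3 := by
    rw [hT3def, Finset.mem_filter, Finset.mem_powersetCard]
    refine ⟨⟨?_, ?_⟩, by rw [hcT]; exact hT⟩
    · intro x hx
      rw [Set.Finite.mem_toFinset] at hx
      rw [hEf, Matroid.groundF, Set.Finite.mem_toFinset]
      exact hT.subset_ground hx
    · rw [← Set.ncard_eq_toFinset_card T hTfin]; exact hT3
  obtain ⟨C, hC, hC4, hdis⟩ := S2.exists_circuit_le_four_disjoint_of_five_triangles (M := M) hC1 T3 hT3mem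
    (by rw [hT3card]; exact h5) hTmem
  rw [hcT] at hdis
  exact ⟨C, hC, hC4, hdis⟩

/-- The tail side of the cell `(15, 6)` on the caps `10 / 34 / 153` with the spanning count `S` a parameter (the kit's rank part `83863299 / 940`). -/
theorem tail_fifteen_six_cf_tk (S m : ℕ) (h : (1024 : ℚ) * ((83863299 / 940 : ℚ) + (S : ℚ)) ≤ (m : ℚ) * 2 ^ 21) :
    1024 * ((((15 + 6).choose 4 : ℚ) +
      (∑ j ∈ Finset.range 6, (Nat.choose (min 5 ((6 + 3) / 2 + 1 - 2)) j : ℚ) / (((j + 1) + 3 * (j + 1).choose 2 + 3 * (j + 1).choose 3 + 2 * (j + 1).choose 4 : ℕ) : ℚ)) *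
        ((10 * (15 + 6 - 3).choose 2 + 34 * (15 + 6 - 4) + 153 : ℕ) : ℚ) +
      ((∑ j ∈ Finset.range 6, (Nat.choose 5 j : ℚ) / (((j + 1) + 3 * (j + 1).choose 2 + 3 * (j + 1).choose 3 + 2 * (j + 1).choose 4 : ℕ) : ℚ)) -
        (∑ j ∈ Finset.range 6, (Nat.choose (min 5 ((6 + 3) / 2 + 1 - 2)) j : ℚ) / (((j + 1) + 3 * (j + 1).choose 2 + 3 * (j + 1).choose 3 + 2 * (j + 1).choose 4 : ℕ) : ℚ))) *
        ((10 : ℕ).choose 5 : ℚ)) +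
      (((15 + 6).choose 3 * 2 ^ 3 + (15 + 6).choose 2 * 2 + (15 + 6) + 1 : ℕ) : ℚ) +
      (((15 + 6).choose 5 : ℚ) + (∑ j ∈ Finset.range (6), (Nat.choose (min 13 ((6 + 6) / 2 + 1 - 2)) j : ℚ) / (((j + 1) + 3 * (j + 1).choose 2 + 3 * (j + 1).choose 3 + 2 * (j + 1).choose 4 : ℕ) : ℚ)) * ((10 * (15 + 6 - 3).choose 3 + 34 * (15 + 6 - 4).choose 2 + 153 * (15 + 6 - 5) + (6 + 5).choose 6 : ℕ) : ℚ) +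
        ((∑ j ∈ Finset.range (6), (Nat.choose (min 19 (5 + 6) - 6) j : ℚ) / (((j + 1) + 3 * (j + 1).choose 2 + 3 * (j + 1).choose 3 + 2 * (j + 1).choose 4 : ℕ) : ℚ)) - (∑ j ∈ Finset.range (6), (Nat.choose (min 13 ((6 + 6) / 2 + 1 - 2)) j : ℚ) / (((j + 1) + 3 * (j + 1).choose 2 + 3 * (j + 1).choose 3 + 2 * (j + 1).choose 4 : ℕ) : ℚ))) *
        ((min 19 (5 + 6)).choose 6 : ℚ)) +
      (S : ℚ)) ≤ (m : ℚ) * 2 ^ (15 + 6) := by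
  have hsm : (∑ j ∈ Finset.range (6), (Nat.choose (min 13 ((6 + 6) / 2 + 1 - 2)) j : ℚ) / (((j + 1) + 3 * (j + 1).choose 2 + 3 * (j + 1).choose 3 + 2 * (j + 1).choose 4 : ℕ) : ℚ)) = 12767 / 4230 := by
    norm_num [Finset.sum_range_succ, Nat.choose]
  have hsg : (∑ j ∈ Finset.range (6), (Nat.choose (min 19 (5 + 6) - 6) j : ℚ) / (((j + 1) + 3 * (j + 1).choose 2 + 3 * (j + 1).choose 3 + 2 * (j + 1).choose 4 : ℕ) : ℚ)) = 12767 / 4230 := by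
    norm_num [Finset.sum_range_succ, Nat.choose]
  have hs4m : (∑ j ∈ Finset.range 6, (Nat.choose (min 5 ((6 + 3) / 2 + 1 - 2)) j : ℚ) / (((j + 1) + 3 * (j + 1).choose 2 + 3 * (j + 1).choose 3 + 2 * (j + 1).choose 4 : ℕ) : ℚ)) = 329 / 180 := by
    norm_num [Finset.sum_range_succ, Nat.choose]
  have hs4g : (∑ j ∈ Finset.range 6, (Nat.choose 5 j : ℚ) / (((j + 1) + 3 * (j + 1).choose 2 + 3 * (j + 1).choose 3 + 2 * (j + 1).choose 4 : ℕ) : ℚ)) = 12767 / 4230 := by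
    norm_num [Finset.sum_range_succ, Nat.choose]
  rw [hsm, hsg, hs4m, hs4g]
  norm_num [Nat.choose] at h ⊢
  linarith

/-- **The coloop-free cell `(15, 6)`, modulo «a spread core of nullity `6` has `≤ 8` triangles»** (`hsix`): the cases `ν = 5, 4` by the
concentrated tail; the spread case by the triangle trade-off — `s₃ ≤ 3`: the sharp count `29875` against the kit's spanning bound
(need `30071`); `s₃ = 4`: `30541` against three triangles' Bonferroni (need `30577`); `5 ≤ s₃ ≤ 8`: the COBASIS charge
(Lemma A: every triangle has a disjoint circuit of `≤ 4` points, so `≤ 452` top `6`-sets through it) — `≤ 30303` against `30577`. -/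
theorem c025_fifteen_six_cf_tk (M : Matroid α) [M.Finite]
    (hR : M.eRank = ((15 : ℕ) : ℕ∞)) (hn : M.E.ncard = 15 + 6)
    (hfree : ∀ e ∈ M.E, ∃ A ⊆ M.E \ {e}, e ∉ M.closure A ∧ e ∉ M.closure ((M.E \ {e}) \ A)) (hK : ∀ e, ¬ M.IsColoop e)
    (hsix : ¬ (∃ W ⊆ M.E, W.ncard ≤ 10 ∧ W.encard = M.eRk W + 5) → ¬ (∃ W ⊆ M.E, W.ncard ≤ 9 ∧ W.encard = M.eRk W + 4) → {C : Set α | M.IsCircuit C ∧ C.ncard = 3}.ncard ≤ 8) :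
    RLS M 15 5 := by
  classical
  have hd : M.E.encard = M.eRank + ((6 : ℕ) : ℕ∞) := by
    rw [hR, ← M.ground_finite.cast_ncard_eq, hn]
    push_cast
    ring
  obtain ⟨hs3, hs4, hs5⟩ := caps_fifteen_six_cf_tk M hd hn hfree hK
  have full : ∀ (k : ℕ) {W : Set α}, W ⊆ M.E → W.encard = M.eRk W + k →
      Matroid.topCount M 15 5 ≤ ∑ m ∈ Finset.Icc 5 6, ∑ j ∈ Finset.Icc (m + k - 6) m,
        W.ncard.choose j * (15 + 6 - W.ncard).choose (m - j) := by
    intro k W hW hWk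
    refine (S2.topCount_le_sum_spanning M hR hd 5).trans ?_
    refine Finset.sum_le_sum (fun m _ => ?_)
    have h := S2.ncard_spanning_compl_le_of_nullity M hW hd hWk (m := m)
    rw [hn] at h
    exact h
  have span : ∀ (k : ℕ) {W : Set α}, W ⊆ M.E → W.encard = M.eRk W + k →
      {X : Set α | X ⊆ M.E ∧ M.eRk X = M.eRank}.ncard ≤ ∑ m ∈ Finset.range (6 + 1), ∑ j ∈ Finset.Icc (m + k - 6) m,
        W.ncard.choose j * (15 + 6 - W.ncard).choose (m - j) := by
    intro k W hW hWk
    have h := S2.ncard_spanning_le_of_nullity M hW hd hWk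
    rw [hn] at h
    exact h
  have cell : ∀ (U S m : ℕ), Matroid.topCount M 15 5 ≤ U → {X : Set α | X ⊆ M.E ∧ M.eRk X = M.eRank}.ncard ≤ S → m ≤ 1024 →
      1024 * (U : ℚ) ≤ ((1024 - m : ℕ) : ℚ) * 2 ^ (6 - 5) * (16173 : ℚ) →
      (1024 : ℚ) * ((83863299 / 940 : ℚ) + (S : ℚ)) ≤ (m : ℚ) * 2 ^ 21 → RLS M 15 5 := by
    intro U S m hU hS hm hpoly htail
    rw [RLS_iff]
    exact c025_core_five_cell_of_topCount_spanning_xqictq5g M 15 6 (by norm_num) hR hn hfree 10 34 153 hs3 hs4 hs5 U hU S hS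
      16173 (by norm_num) (phiK 15 5) (by rw [S2.phiK_fifteen_five]; norm_num) ⟨m, hm, hpoly, tail_fifteen_six_cf_tk S m htail⟩
  have cellA : ∀ (U S m : ℕ) (A : ℚ), Matroid.topCount M 15 5 ≤ U → {X : Set α | X ⊆ M.E ∧ M.eRk X = M.eRank}.ncard ≤ S → m ≤ 1024 →
      1024 * (U : ℚ) ≤ ((1024 - m : ℕ) : ℚ) * 2 ^ (6 - 5) * (16173 : ℚ) →
      (1024 : ℚ) * (A + (S : ℚ)) ≤ (m : ℚ) * 2 ^ 21 →
      ({X : Set α | X ⊆ M.E ∧ M.eRk X ≤ 5}.ncard : ℚ) ≤ A → RLS M 15 5 := by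
    intro U S m A hU hS hm hpoly htail hA
    rw [RLS_iff]
    exact c025_core_five_cell_of_counts_xqictq5g M 15 6 (by norm_num) hR hn U hU _ hA S hS
      16173 (by norm_num) (phiK 15 5) (by rw [S2.phiK_fifteen_five]; norm_num) ⟨m, hm, hpoly, htail⟩
  by_cases h5 : ∃ W ⊆ M.E, W.ncard ≤ 10 ∧ W.encard = M.eRk W + 5
  · obtain ⟨W, hW, hWn, hWk⟩ := h5
    have hU' : Matroid.topCount M 15 5 ≤ 5544 := by
      refine (full 5 hW hWk).trans ?_
      generalize W.ncard = w at hWn ⊢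
      interval_cases w <;> decide
    have hS' : {X : Set α | X ⊆ M.E ∧ M.eRk X = M.eRank}.ncard ≤ 7866 := by
      refine (span 5 hW hWk).trans ?_
      generalize W.ncard = w at hWn ⊢
      interval_cases w <;> decide
    exact cell 5544 7866 48 hU' hS' (by norm_num) (by norm_num) (by norm_num)
  by_cases h4 : ∃ W ⊆ M.E, W.ncard ≤ 9 ∧ W.encard = M.eRk W + 4
  · obtain ⟨W, hW, hWn, hWk⟩ := h4
    have hU' : Matroid.topCount M 15 5 ≤ 17094 := by
      refine (full 4 hW hWk).trans ?_
      generalize W.ncard = w at hWn ⊢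
      interval_cases w <;> decide
    have hS' : {X : Set α | X ⊆ M.E ∧ M.eRk X = M.eRank}.ncard ≤ 21946 := by
      refine (span 4 hW hWk).trans ?_
      generalize W.ncard = w at hWn ⊢
      interval_cases w <;> decide
    exact cell 17094 21946 55 hU' hS' (by norm_num) (by norm_num) (by norm_num)
  · -- spread: rank-`5` sets `≤ 8`, rank-`4` sets `≤ 7`; the triangle trade-off and the cobasis charge
    have hflat : ∀ X ⊆ M.E, M.eRk X ≤ 5 → X.ncard ≤ 8 := fun X hX hr => by
      have := S2.ncard_le_of_eRk_le_of_not_nullity M 4 9 (by norm_num) h4 hX (r := 5) (by norm_num) (by exact_mod_cast hr)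
      omega
    have hflat' : ∀ X ⊆ M.E, M.eRk X ≤ 4 → X.ncard ≤ 7 := fun X hX hr => by
      have := S2.ncard_le_of_eRk_le_of_not_nullity M 4 9 (by norm_num) h4 hX (r := 4) (by norm_num) (by exact_mod_cast hr)
      omega
    have hA := ncard_eRk_le_five_le_spread M 15 6 (by norm_num) hR hn hfree hflat hflat' 10 34 153 hs3 hs4 hs5
    have hEcard : M.ground_finite.toFinset.card = 15 + 6 := by
      rw [← Set.ncard_eq_toFinset_card _ M.ground_finite]; exact hn
    have hL0 : ∀ e ∈ M.E, ¬ M.IsLoop e := not_isLoop_of_free M hfree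
    have hs : ∀ e ∈ M.E, ∀ f ∈ M.E, e ≠ f → M.eRk {e, f} = 2 := by
      intro e he f hf hef
      have h2 : (2 : ℕ∞) ≤ M.eRk {e, f} :=
        two_le_eRk_of_two_le_ncard_of_free M hfree (pair_subset he hf) (by rw [ncard_pair hef])
      have h3 : M.eRk {e, f} ≤ 2 := by
        have := M.eRk_le_encard {e, f}
        rwa [encard_pair hef] at this
      exact le_antisymm h3 h2
    have hC1 : ∀ L ⊆ M.E, M.eRk L = 2 → L.ncard ≤ 3 :=
      fun L hL hr => ncard_le_three_of_eRk_two M hs hfree hL hr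
    have hcirc : ∀ C, M.IsCircuit C → 3 ≤ C.encard := three_le_encard_of_circuit M hL0 hs
    have hTfin : {C : Set α | M.IsCircuit C ∧ C.ncard = 3}.Finite :=
      M.ground_finite.finite_subsets.subset (fun C hC => hC.1.subset_ground)
    -- three triangles' Bonferroni on the spanning sets, once `s₃ ≥ 3`
    have hspan3 : 3 ≤ {C : Set α | M.IsCircuit C ∧ C.ncard = 3}.ncard → {X : Set α | X ⊆ M.E ∧ M.eRk X = M.eRank}.ncard ≤ 50492 := by
      intro h3
      obtain ⟨T₁, T₂, T₃, hT₁, hT₂, hT₃, h12, h13, h23⟩ := (Set.two_lt_ncard_iff hTfin).1 (by omega)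
      have hS := S2.ncard_spanning_add_le_of_three_triangles M hR hn (by norm_num) hC1 hT₁.1 hT₁.2 hT₂.1 hT₂.2 hT₃.1 hT₃.2 h12 h13 h23
      norm_num [Finset.sum_range_succ, Nat.choose] at hS
      omega
    by_cases ht3 : {C : Set α | M.IsCircuit C ∧ C.ncard = 3}.ncard ≤ 3
    · have hU := topCount_le_flat_sharp M 15 6 (by norm_num) (by norm_num) hR hn hfree 8 7 hflat hflat' (by norm_num) (by norm_num)
        3 34 153 ht3 hs4 hs5
      norm_num [Finset.sum_range_succ, Nat.choose] at hU
      have hU' : Matroid.topCount M 15 5 ≤ 29875 := hU.trans (by norm_num)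
      have hS := Matroid.ncard_spanning_le (M := M) hd
      rw [hEcard] at hS
      have hS' : {X : Set α | X ⊆ M.E ∧ M.eRk X = M.eRank}.ncard ≤ 82160 := hS.trans (by decide)
      exact cellA 29875 82160 72 _ hU' hS' (by norm_num) (by norm_num) (by norm_num [Nat.choose]) hA
    push Not at ht3
    have hS' := hspan3 (by omega)
    by_cases ht4 : {C : Set α | M.IsCircuit C ∧ C.ncard = 3}.ncard ≤ 4
    · have hU := topCount_le_flat_sharp M 15 6 (by norm_num) (by norm_num) hR hn hfree 8 7 hflat hflat' (by norm_num) (by norm_num)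
        4 34 153 ht4 hs4 hs5
      norm_num [Finset.sum_range_succ, Nat.choose] at hU
      have hU' : Matroid.topCount M 15 5 ≤ 30541 := hU.trans (by norm_num)
      exact cellA 30541 50492 56 _ hU' hS' (by norm_num) (by norm_num) (by norm_num [Nat.choose]) hA
    push Not at ht4
    -- `5 ≤ s₃ ≤ 8`: the cobasis charge
    have ht8 : {C : Set α | M.IsCircuit C ∧ C.ncard = 3}.ncard ≤ 8 := hsix h5 h4
    have htri : ∀ T : Set α, M.IsCircuit T → T.ncard = 3 →
        {B : Set α | B ⊆ M.E ∧ B.ncard = 6 ∧ T ⊆ B ∧ M.eRk (M.E \ B) = M.eRank}.ncard ≤ 452 := by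
      intro T hT hT3
      obtain ⟨C', hC', hC'4, hdis⟩ := exists_circuit_le_four_disjoint_of_five_triangles_set M hC1 (by omega) hT hT3
      have hC'fin : C'.Finite := M.ground_finite.subset hC'.subset_ground
      have hC'3 : 3 ≤ C'.ncard := by
        have := hcirc C' hC'
        rw [← hC'fin.cast_ncard_eq] at this
        exact_mod_cast this
      have h := S2.ncard_cobases_through_add_le M hR hn hT.subset_ground hC' hdis (by omega)
      rw [hn, hT3] at h
      generalize hc : C'.ncard = c at h hC'3 hC'4
      interval_cases c <;> norm_num [Nat.choose] at h <;> omega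
    have htop := S2.ncard_top_six_le M hn hcirc 452 htri
    have hI5 := S2.ncard_indep_five_add_le (M := M) hC1
    rw [hn] at hI5
    have hU1 := S2.topCount_le_ncard_compl_spanning (M := M) hR hd 5
    simp only [Nat.cast_ofNat] at hU1
    have hsplit : {B : Set α | B ⊆ M.E ∧ M.eRk B = 5 ∧ B.ncard ≤ 6 ∧ M.eRk (M.E \ B) = M.eRank}.ncard ≤
        {B : Set α | B ⊆ M.E ∧ B.ncard = 5 ∧ M.eRk B = 5}.ncard +
        {B : Set α | B ⊆ M.E ∧ B.ncard = 6 ∧ M.eRk B = 5 ∧ M.eRk (M.E \ B) = M.eRank}.ncard := by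
      refine le_trans (Set.ncard_le_ncard ?_ ((M.ground_finite.finite_subsets.subset (fun B hB => hB.1)).union
        (M.ground_finite.finite_subsets.subset (fun B hB => hB.1)))) (Set.ncard_union_le _ _)
      rintro B ⟨hBE, hB5, hB6, hBs⟩
      have hBfin : B.Finite := M.ground_finite.subset hBE
      have h5le : 5 ≤ B.ncard := by
        have := M.eRk_le_encard B
        rw [hB5, ← hBfin.cast_ncard_eq] at this
        exact_mod_cast this
      rcases (show B.ncard = 5 ∨ B.ncard = 6 by omega) with h | h
      · exact Or.inl ⟨hBE, h, hB5⟩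
      · exact Or.inr ⟨hBE, h, hB5, hBs⟩
    have hU' : Matroid.topCount M 15 5 ≤ 30303 := by
      have hs6 : {C : Set α | M.IsCircuit C ∧ C.ncard = 6}.ncard ≤ (6 + 5).choose 6 :=
        Matroid.ncard_circuits_le_choose_of_encard M hd 5
      norm_num [Nat.choose] at hI5 htop hs6
      generalize {C : Set α | M.IsCircuit C ∧ C.ncard = 3}.ncard = t at hI5 htop ht4 ht8
      interval_cases t <;> norm_num [Nat.choose] at hI5 <;> omega
    exact cellA 30303 50492 56 _ hU' hS' (by norm_num) (by norm_num) (by norm_num [Nat.choose]) hA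

/-- **THE CELL `(15, 6)` modulo «a spread core of nullity `6` has `≤ 8` triangles»** (the hypothesis `hsix`, stated for every finite
matroid): the coloop cases through the scaled cells `(14, 6)` / `(13, 6)` (S2FifteenSixScaled), the coloop-free case through
`c025_fifteen_six_cf_tk`. -/
theorem c025_core_five_fifteen_six_of_triangles
    (hsix : ∀ (M : Matroid α) [M.Finite], M.eRank = ((15 : ℕ) : ℕ∞) → M.E.ncard = 15 + 6 →
      (∀ e ∈ M.E, ∃ A ⊆ M.E \ {e}, e ∉ M.closure A ∧ e ∉ M.closure ((M.E \ {e}) \ A)) →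
      ¬ (∃ W ⊆ M.E, W.ncard ≤ 10 ∧ W.encard = M.eRk W + 5) → ¬ (∃ W ⊆ M.E, W.ncard ≤ 9 ∧ W.encard = M.eRk W + 4) →
      {C : Set α | M.IsCircuit C ∧ C.ncard = 3}.ncard ≤ 8)
    (M : Matroid α) [M.Finite]
    (hR : M.eRank = ((15 : ℕ) : ℕ∞)) (hn : M.E.ncard = 15 + 6)
    (hfree : ∀ e ∈ M.E, ∃ A ⊆ M.E \ {e}, e ∉ M.closure A ∧ e ∉ M.closure ((M.E \ {e}) \ A)) : RLS M 15 5 := by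
  classical
  by_cases hK : ∃ e, M.IsColoop e
  · obtain ⟨e, he⟩ := hK
    obtain ⟨hn', hR', hfree', -⟩ := delete_core_data M he (p := 14) (d := 6) (by rw [hR]) hn hfree
    rw [RLS_iff]
    by_cases hK' : ∃ f, (M ＼ {e}).IsColoop f
    · obtain ⟨f, hf⟩ := hK'
      obtain ⟨hn'', hR'', hfree'', -⟩ := delete_core_data (M ＼ {e}) hf (p := 13) (d := 6) (by rw [hR']) hn' hfree'
      have key := c025_thirteen_six_scaled ((M ＼ {e}) ＼ {f}) hR'' hn'' hfree''
      exact weighted_of_isColoop_scaled_sharp_iter M he hf (by norm_num : 4 + 1 < 13) (by rw [hR]) (phiK 15 5) key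
    · push Not at hK'
      have key := c025_fourteen_six_scaled_cf (M ＼ {e}) hR' hn' hfree' hK'
      exact weighted_of_isColoop_scaled_sharp M he (by norm_num : 4 + 1 < 14) (by rw [hR]) (phiK 15 5) key
  · push Not at hK
    exact c025_fifteen_six_cf_tk M hR hn hfree hK (hsix M hR hn hfree)

end ThmN

end PercRepro
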